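import Summits.BirchSwinnertonDyer.Rank1Residual.X12.O11.RamifiedEllipticUnitMechanism
import Literature.NumberTheory.EllipticCurves.BurungaleKobayashiNakamuraOta2026.PadicEndSpan
import HarnessLib

/-!
# O11 (CM, analytic rank one, the RAMIFIED prime `p = |d_K| ≥ 5`): the elliptic-unit MECHANISM over the
# CORRECTED carrier `𝒪_𝔭 · z(𝟙)` (the `p`-adic span `padicEndSpan`) — (R-IMC)∃-Zp, (R-PR)|IMC-Zp and the
# PROVED seams (cell `bsd-cm`, planner DECISION D117 (R3) + addendum (A1); seat `bsd-cm-k7r-c4` g5;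
# NOTHING asserted)

HONEST FRAMING. This is the `…Zp` twin of `RamifiedEllipticUnitMechanism.lean` (same seat, rev-8
STEP A″). The carrier audit (cell memo `MEMO-k7r-c4-g5-CARRIER.md`, evidence #10 on item 19705; seats
k7r-c2 `SB4-RECUT.md`, k8i-c2 `Theorems/RamifiedSevenEllipticUnitsBottomIndexVacuity.lean`) showed that
the exponent `D.HasBottomIndexExp c` of the original module is built on the ℤ-span `endSpan` of the
`End_K(E)`-translates of `z(𝟙)` and is therefore UNSATISFIABLE at every positive-rank frame: the
original `RamifiedCMEllipticUnitIMCAt` / `RamifiedCMBottomClassExistsAt` are real-world FALSE and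
`RamifiedCMBottomClassIndexLawAt` is VACUOUSLY true. Planner D117 adopted the repair: the Literature
module `BurungaleKobayashiNakamuraOta2026/PadicEndSpan.lean` (R1)+(R2) types the `p`-adic span
`𝒪_𝔭 · x = (End_K(E) ⊗ ℤ_p) · x` and the exponents `HasBottomIndexExpZp` / `HasLocalBottomIndexExpZp`;
this module (R3) re-types the three class-level predicates over it, VERBATIM except for:
(a) `HasBottomIndexExp` ↦ `HasBottomIndexExpZp`; (b) D117 addendum (A1): the datum's Hecke character is
PINNED to the curve by the clause `∀ s, 3/2 < re s → L(φ, s) = L(W, s)` (the clause (v) of the tree's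
`Deuring_exists_heckeCharacter_of_maximalCM`, exactly as in the existence claim `RubinEllipticUnitClasses`;
k7r-c2's SB4-RECUT option (A) — smallest blast radius, `EllipticUnitClassData` is not re-opened) and the
period is non-zero, `Ω ≠ 0` (tribunal T1 (ii) sharpening). In the ∀-form (R-PR)|IMC-Zp these binders only
WEAKEN the statement (fewer data to treat); in the ∃-form (R-IMC)∃-Zp they say what was always meant.

* `RamifiedCMBottomClassExistsAtZp W p` — `@[conjecture]` (nothing asserted): at every analytic-rank-one
  O11 frame some PINNED datum `(ι, φ, Ω ≠ 0, 𝓔, D)` has a bottom index exponent over `𝒪_𝔭 · z(𝟙)`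
  (satisfiable now: `[S_{p,rel}(E/K) : tors + 𝒪_𝔭·z(𝟙)] = #𝒪_𝔭/π^c = p^c` in rank one; cite-level).
* `RamifiedCMEllipticUnitIMCAtZp W p` — `@[conjecture]` (nothing asserted): **(R-IMC)∃-Zp** — SOME pinned
  datum has an exponent `c` over `𝒪_𝔭 · z(𝟙)` with `n₀ + log_p #X[T] = c` ([BKNO] Thm. 3.14 (3) ⇐ Rubin
  1991 Thm. 4.1 + JLK 2011 Thm. 5.2 + descent, read at `T = 0`). The route's cite-level SUPPORT (residual).
* `RamifiedCMBottomClassIndexLawAtZp W p` — `@[conjecture]` (nothing asserted): **(R-PR)|IMC-Zp** — for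
  EVERY pinned datum and exponent `c` over `𝒪_𝔭 · z(𝟙)` with the IMC identity, `c = n + n' + ord_p q +
  ord_p q'`. The ATTACKED value piece ((★_an); [BKNO] §1.4 «report elsewhere»); OPEN; NOT in print.
* Seams, PROVED verbatim: `ramifiedCMBottomClassExistsAtZp_of_imcAtZp`,
  `ramifiedCMEllipticUnitIndexAt_of_imcZp_of_indexLawZp` ((R-IMC)∃-Zp ∧ (R-PR)|IMC-Zp ⟹ (R-EU)),
  `ramifiedCMBottomClassIndexLawAtZp_of_indexAt` ((R-EU) ∧ (R-tors) ⟹ (R-PR)|IMC-Zp).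

Nothing is asserted; no named fact is minted; (R-EU), O11 and the K7r leaf stay OPEN. The planner's
edit E-Zp (turnkey `pub/bsd-cm/bsd-cm-plan/g19/ezp/`) files the items `EllipticUnitIMCSevenZp` /
`EllipticUnitValueSevenOfGZK` over these bodies through `Theorems/RamifiedSevenEllipticUnitsMechanismBridgeZp.lean`.
References: [BKNO] arXiv:2608.06879 (2026) §3.3.1, Prop. 3.7, Thm. 3.14 (3), Prop. 4.10, Thm. 7.2, §1.4
[BurungaleKobayashiNakamuraOta2026]; K. Rubin, Invent. Math. 103 (1991) Thm. 4.1 [Rubin1991MainConj];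
J. Johnson-Leung, G. Kings, J. reine angew. Math. 653 (2011) Thm. 5.2 [JohnsonLeungKings2011]; B. Perrin-Riou,
Ann. Inst. Fourier 43 (1993) §3.3; cell memos MEMO-k7r-c4-g5-CARRIER.md, SB4-RECUT.md, STATUS D117.
-/

noncomputable section

open scoped Classical

open WeierstrassCurve NumberField IsDedekindDomain Field PowerSeries
  Literature.NumberTheory.EllipticCurves
  Literature.NumberTheory.EllipticCurves.Rank1Residual
  Literature.NumberTheory.EllipticCurves.Rank1Residual.Typed
  Literature.NumberTheory.EllipticCurves.Castella2018
  Literature.NumberTheory.EllipticCurves.BurungaleKobayashiNakamuraOta2026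
  Literature.NumberTheory.GaloisRepresentations
  Summit.BirchSwinnertonDyer.Rank1Residual.Additive

namespace Summit.BirchSwinnertonDyer.Rank1Residual.X12.O11

variable (W : WeierstrassCurve ℚ) [W.IsElliptic] [W.IsGloballyMinimal] (p : ℕ) [Fact p.Prime]

section EllipticUnitMechanismZp

/-- **CONSTRUCTION CLAIM TYPED over the corrected carrier (nothing asserted): at a framed O11 pair of
analytic rank one, for every anticyclotomic `ℤ_p`-tower with a topological generator, SOME anticyclotomic
elliptic-unit class datum `(ι, φ, Ω, 𝓔, D)` — PINNED: `Ω ≠ 0` and `L(φ, s) = L(W, s)` on `re s > 3/2` —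
has a bottom index exponent `c` over the `p`-adic span**, `D.HasBottomIndexExpZp c`
(`p^c = [S_{p,rel}(E/K) : tors + 𝒪_𝔭 · z(𝟙)]`, finite in rank one). Cite-level: [BKNO] §3.3.1 (3.8)–(3.9)
(existence: the tree's claim `RubinEllipticUnitClasses`, whose conclusion carries exactly the pinning
clauses) + Prop. 3.7 (1) (non-vanishing of `z(𝟙)` in analytic rank one). PREPRINT, shape only. OPEN;
nothing booked. [cite: BurungaleKobayashiNakamuraOta2026, §3.3.1 (3.8)–(3.9) and Prop. 3.7 (arXiv:2608.06879 pp. 19–20) (claim; preprint; shape only)]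
[cite: SilvermanATAEC1994, Ch. II Thm. 10.5 (b) (the clause `L(φ,s) = L(E/ℚ,s)` pinning `φ`)] -/
@[conjecture] def RamifiedCMBottomClassExistsAtZp : Prop :=
  ∀ (K : Type) [Field K] [NumberField K] (𝔭 : HeightOneSpectrum (𝓞 K))
    (W' : WeierstrassCurve ℚ) [W'.IsElliptic] [W'.IsGloballyMinimal] (C : VariableChange ℚ),
    IsFrame W p K 𝔭 W' C → W.analyticRank = 1 →
    ∀ (κ : ZpExtension K p), κ.IsAnticyclotomic →
      ∀ (γ : absoluteGaloisGroup K) [Fact (κ.IsTopGenerator γ)],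
        ∃ (ι : PadicAlgCl p ≃+* ℂ) (φ : HeckeCharacter K) (Ω : ℂ) (𝓔 : AcDualExpSystem W p K 𝔭 κ ι)
          (D : EllipticUnitClassData W p K 𝔭 κ γ ι φ Ω 𝓔) (c : ℕ),
          Ω ≠ 0 ∧ (∀ s : ℂ, 3 / 2 < s.re → heckeLFunction φ s = W.LSeries s) ∧
          D.HasBottomIndexExpZp c

/-- **(R-IMC)∃-Zp TYPED (nothing asserted): the elliptic-unit MAIN-CONJECTURE VALUATION IDENTITY at a
CM-ramified prime in analytic rank one, in junk-free existential form, over the corrected carrier.** At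
every framed pair and every anticyclotomic tower with generator, SOME PINNED datum `(ι, φ, Ω, 𝓔, D)`
(`Ω ≠ 0`, `L(φ, s) = L(W, s)` on `re s > 3/2`) has a bottom index exponent `c` over `𝒪_𝔭 · z(𝟙)`
(`D.HasBottomIndexExpZp c`) such that, whenever the strict anticyclotomic Selmer dual `X` has
`ord_p f(0) = n₀` and finite `X[T]`, `n₀ + log_p #X[T] = c`. SOURCE: [BKNO] Thm. 3.14 (3)
(`Ch_Λ(X_str) = Ch_Λ(𝒮_rel/Λ·z^ac)` ⇐ Rubin 1991 Thm. 4.1 + Johnson-Leung–Kings 2011 Thm. 5.2 + descent)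
read at `T = 0` through the Euler characteristic and exact bottom control — for the GENUINE, integrally
normalised class; the rescaled (junk) data of ram's `scaleByP` cannot refute an existential statement.
The route's cite-level SUPPORT piece (residual); preprint + the cell's derivation, never a Literature
fact while unrefereed. Twin of `RamifiedCMEllipticUnitIMCAt` (ℤ-span carrier, real-world false: D117).
Nothing booked. [cite: BurungaleKobayashiNakamuraOta2026, Thm. 3.14 (3) (arXiv:2608.06879 pp. 22–24) (claim; preprint; shape only)]
[cite: GreenbergLNM1716, §4 Lemma 4.2 (p. 102) (Euler characteristic; shape only)] -/
@[conjecture] def RamifiedCMEllipticUnitIMCAtZp : Prop :=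
  ∀ (K : Type) [Field K] [NumberField K] (𝔭 : HeightOneSpectrum (𝓞 K))
    (W' : WeierstrassCurve ℚ) [W'.IsElliptic] [W'.IsGloballyMinimal] (C : VariableChange ℚ),
    IsFrame W p K 𝔭 W' C → W.analyticRank = 1 →
    ∀ (κ : ZpExtension K p), κ.IsAnticyclotomic →
      ∀ (γ : absoluteGaloisGroup K) [Fact (κ.IsTopGenerator γ)],
        ∃ (ι : PadicAlgCl p ≃+* ℂ) (φ : HeckeCharacter K) (Ω : ℂ) (𝓔 : AcDualExpSystem W p K 𝔭 κ ι)
          (D : EllipticUnitClassData W p K 𝔭 κ γ ι φ Ω 𝓔) (c : ℕ),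
          Ω ≠ 0 ∧ (∀ s : ℂ, 3 / 2 < s.re → heckeLFunction φ s = W.LSeries s) ∧
          D.HasBottomIndexExpZp c ∧
          ∀ (n₀ : ℕ), AcSelmer.XAc.HasCharValuationAt (W.baseChange K) p κ 𝔭 ∅ γ n₀ →
            Finite {x : AcSelmer.XAc (W.baseChange K) p κ 𝔭 ∅ γ //
              (PowerSeries.X : IwasawaAlgebra p) • x = 0} →
            (n₀ : ℤ) + padicValNat p (Nat.card {x : AcSelmer.XAc (W.baseChange K) p κ 𝔭 ∅ γ //
                (PowerSeries.X : IwasawaAlgebra p) • x = 0}) = c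

/-- **(R-PR)|IMC-Zp TYPED (the ATTACKED statement over the corrected carrier; NOT in print; nothing
asserted): Perrin-Riou's law for the bottom elliptic-unit class at a CM-ramified prime in analytic rank
one, RELATIVE to the main-conjecture identity.** For a framed pair with generators of levels `n`, `n'`
and `#Ш_an(W) = q`, `#Ш_an(W') = q'` (the binders of (R-EU)), for EVERY PINNED datum
`D : EllipticUnitClassData W p K 𝔭 κ γ ι φ Ω 𝓔` (`Ω ≠ 0`, `L(φ, s) = L(W, s)` on `re s > 3/2`) and every
`c` with `D.HasBottomIndexExpZp c` (`p^c = [S_{p,rel}(E/K) : tors + 𝒪_𝔭 · z(𝟙)]`) which satisfies the IMC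
identity `n₀ + log_p #X[T] = c` (for all `n₀` with `ord_p f(0) = n₀`, `X[T]` finite):
`c = n + n' + ord_p q + ord_p q'`. On the genuine class this is (★_an) — what a ramified-prime explicit
reciprocity / BDP-type formula proves ([BKNO] Thm. 7.2: ⟺ a formula for `𝓛(𝟙)`; §1.4 «report
elsewhere»); junk data (IMC identity false) satisfy it vacuously. Twin of `RamifiedCMBottomClassIndexLawAt`
(ℤ-span carrier, vacuous: D117) with the two pinning binders, which only weaken the ∀-statement. LABEL:
CONSTRUCTION / OPEN. In the kernel: `ramifiedCMBottomClassIndexLawAtZp_of_indexAt` ((R-EU) ∧ (R-tors) ⟹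
this) and `ramifiedCMEllipticUnitIndexAt_of_imcZp_of_indexLawZp` ((R-IMC)∃-Zp ∧ this ⟹ (R-EU)).
[cite: BurungaleKobayashiNakamuraOta2026, Thm. 7.2 and §1.4 (arXiv:2608.06879 pp. 8, 41) (claim; preprint; shape only)]
[cite: GrossZagier1986, Thm. I.(7.3) (rationality of #Ш_an)] -/
@[conjecture] def RamifiedCMBottomClassIndexLawAtZp : Prop :=
  ∀ (K : Type) [Field K] [NumberField K] (𝔭 : HeightOneSpectrum (𝓞 K))
    (W' : WeierstrassCurve ℚ) [W'.IsElliptic] [W'.IsGloballyMinimal] (C : VariableChange ℚ),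
    IsFrame W p K 𝔭 W' C → W.analyticRank = 1 →
    ∀ (κ : ZpExtension K p), κ.IsAnticyclotomic →
      ∀ (γ : absoluteGaloisGroup K) [Fact (κ.IsTopGenerator γ)]
        (P : W.toAffine.Point) (n : ℕ) (P' : W'.toAffine.Point) (n' : ℕ),
        ¬ IsOfFinAddOrder P →
        (∀ R : W.toAffine.Point, ∃ (k : ℤ) (T : W.toAffine.Point), IsOfFinAddOrder T ∧ R = k • P + T) →
        (∀ Q : (W.baseChange ℚ_[p]).toAffine.Point, p • Q = 0 → Q = 0) →
        (∃ Q : (W.baseChange ℚ_[p]).toAffine.Point, p ^ n • Q = W.toPadicPoint p P) →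
        (∀ Q : (W.baseChange ℚ_[p]).toAffine.Point, p ^ (n + 1) • Q ≠ W.toPadicPoint p P) →
        ¬ IsOfFinAddOrder P' →
        (∀ R : W'.toAffine.Point, ∃ (k : ℤ) (T : W'.toAffine.Point),
          IsOfFinAddOrder T ∧ R = k • P' + T) →
        (∀ Q : (W'.baseChange ℚ_[p]).toAffine.Point, p • Q = 0 → Q = 0) →
        (∃ Q : (W'.baseChange ℚ_[p]).toAffine.Point, p ^ n' • Q = W'.toPadicPoint p P') →
        (∀ Q : (W'.baseChange ℚ_[p]).toAffine.Point, p ^ (n' + 1) • Q ≠ W'.toPadicPoint p P') →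
        ∀ (q q' : ℚ), shaAn W = (q : ℂ) → shaAn W' = (q' : ℂ) →
        ∀ (ι : PadicAlgCl p ≃+* ℂ) (φ : HeckeCharacter K) (Ω : ℂ) (𝓔 : AcDualExpSystem W p K 𝔭 κ ι)
          (D : EllipticUnitClassData W p K 𝔭 κ γ ι φ Ω 𝓔) (c : ℕ),
          Ω ≠ 0 → (∀ s : ℂ, 3 / 2 < s.re → heckeLFunction φ s = W.LSeries s) →
          D.HasBottomIndexExpZp c →
          (∀ (n₀ : ℕ), AcSelmer.XAc.HasCharValuationAt (W.baseChange K) p κ 𝔭 ∅ γ n₀ →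
            Finite {x : AcSelmer.XAc (W.baseChange K) p κ 𝔭 ∅ γ //
              (PowerSeries.X : IwasawaAlgebra p) • x = 0} →
            (n₀ : ℤ) + padicValNat p (Nat.card {x : AcSelmer.XAc (W.baseChange K) p κ 𝔭 ∅ γ //
                (PowerSeries.X : IwasawaAlgebra p) • x = 0}) = c) →
          (c : ℤ) = (n : ℤ) + n' + padicValRat p q + padicValRat p q'

variable {W p}

omit [W.IsGloballyMinimal] in
/-- **(R-IMC)∃-Zp ⟹ existence-Zp** (PROVED; the existence conjunct is redundant but harmless).
[cite: BurungaleKobayashiNakamuraOta2026, Prop. 3.7 (arXiv:2608.06879 p. 20) (shape only)] -/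
theorem ramifiedCMBottomClassExistsAtZp_of_imcAtZp (h1 : RamifiedCMEllipticUnitIMCAtZp W p) :
    RamifiedCMBottomClassExistsAtZp W p := by
  intro K _ _ 𝔭 W' _ _ C hF hr κ hκ γ _
  obtain ⟨ι, φ, Ω, 𝓔, D, c, hΩ, hφ, hc, -⟩ := h1 K 𝔭 W' C hF hr κ hκ γ
  exact ⟨ι, φ, Ω, 𝓔, D, c, hΩ, hφ, hc⟩

omit [W.IsGloballyMinimal] in
/-- **(R-IMC)∃-Zp ∧ (R-PR)|IMC-Zp ⟹ (R-EU)** (PROVED; the seam of the repaired split): take the pinned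
datum and exponent `c` provided by the IMC piece, read `n₀ + log_p #X[T] = c` from its identity and
`c = n + n' + ord_p q + ord_p q'` from the relative law. Trivial by design (BC2 «trivial_seam»): the
content is in the two hypotheses, neither of which gives (R-EU) or the leaf alone. [cite: Miller2011LMS, Def. 1.1] -/
theorem ramifiedCMEllipticUnitIndexAt_of_imcZp_of_indexLawZp
    (h1 : RamifiedCMEllipticUnitIMCAtZp W p) (h2 : RamifiedCMBottomClassIndexLawAtZp W p) :
    RamifiedCMEllipticUnitIndexAt W p := by
  intro K _ _ 𝔭 W' _ _ C hF hr κ hκ γ _ P n P' n' hP hgen htors hdiv hndiv hP' hgen' htors' hdiv' hndiv'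
    q q' hq hq' n₀ hn₀ hfin
  obtain ⟨ι, φ, Ω, 𝓔, D, c, hΩ, hφ, hc, himc⟩ := h1 K 𝔭 W' C hF hr κ hκ γ
  have e1 := himc n₀ hn₀ hfin
  have e2 := h2 K 𝔭 W' C hF hr κ hκ γ P n P' n' hP hgen htors hdiv hndiv hP' hgen' htors' hdiv' hndiv'
    q q' hq hq' ι φ Ω 𝓔 D c hΩ hφ hc himc
  rw [e1, e2]

omit [W.IsGloballyMinimal] in
/-- The same seam with the existence conjunct displayed (not used). [cite: Miller2011LMS, Def. 1.1] -/
theorem ramifiedCMEllipticUnitIndexAt_of_existsZp_of_imcZp_of_indexLawZp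
    (_hex : RamifiedCMBottomClassExistsAtZp W p) (h1 : RamifiedCMEllipticUnitIMCAtZp W p)
    (h2 : RamifiedCMBottomClassIndexLawAtZp W p) : RamifiedCMEllipticUnitIndexAt W p :=
  ramifiedCMEllipticUnitIndexAt_of_imcZp_of_indexLawZp h1 h2

omit [W.IsGloballyMinimal] in
/-- **(R-EU) ∧ (R-tors) ⟹ (R-PR)|IMC-Zp** (PROVED; the converse seam): given a pinned datum with exponent
`c` over `𝒪_𝔭 · z(𝟙)` and its IMC identity, (R-tors) supplies `n₀` and the finiteness of `X[T]`, the IMC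
identity gives `n₀ + log_p #X[T] = c`, and (R-EU) gives `n₀ + log_p #X[T] = n + n' + ord_p q + ord_p q'`.
So, modulo (R-tors) (a theorem under GZK), the repaired relative law is EXACTLY as strong as (R-EU): the
pinning binders and the corrected carrier change nothing in this direction. [cite: Miller2011LMS, Def. 1.1] -/
theorem ramifiedCMBottomClassIndexLawAtZp_of_indexAt (h3 : RamifiedCMEllipticUnitIndexAt W p)
    (htors : RamifiedCMStrictTorsionAt W p) : RamifiedCMBottomClassIndexLawAtZp W p := by
  intro K _ _ 𝔭 W' _ _ C hF hr κ hκ γ _ P n P' n' hP hgen htor hdiv hndiv hP' hgen' htor' hdiv' hndiv'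
    q q' hq hq' ι φ Ω 𝓔 D c _hΩ _hφ _hc himc
  obtain ⟨⟨n₀, hn₀⟩, hfin⟩ := htors K 𝔭 W' C hF hr κ hκ γ
  have e1 := himc n₀ hn₀ hfin
  have e3 := h3 K 𝔭 W' C hF hr κ hκ γ P n P' n' hP hgen htor hdiv hndiv hP' hgen' htor' hdiv' hndiv'
    q q' hq hq' n₀ hn₀ hfin
  rw [← e1, e3]

end EllipticUnitMechanismZp

end Summit.BirchSwinnertonDyer.Rank1Residual.X12.O11

end
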